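import Literature.NumberTheory.EllipticCurves.Greenberg1999.LocalTowerKummerVanishingProofs
import Literature.NumberTheory.EllipticCurves.ZpExtensionGaloisTwist
import HarnessLib

/-!
# Road T for item 23110, brick (R4) part 1: the local `ℤ_p`-extension at a completion with a PRESCRIBED topological generator,
# and the twist exponent of an admissible element

Route `ResidualThetaTransportAtTwo` (RTT, crux r201 `ResidualLambdaFormulaNegDiscAtTwo`, stmt-BirchSwinnertonDyer-23110) /
`ThetaPartnerAtTwo` (TP2, aside r205). Seat `prover-bsd-wall-tp2-p2x-w3` g12; `--supports stmt-BirchSwinnertonDyer-23110`. THEOREMS ONLY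
(no definition, no named fact, no `sorry`); closes nothing. Preliminaries of `…RlfTwistedLocalDescentAwayP` (the twisted local
`Γ`-descent (LOC-S₀) = (R4) of the lead's memo RLF-TWIST-ROAD-g12 §3), where the eigenvector condition `u^N · conj_g z = z` refers to a
GIVEN local element `g ∈ Γ_{K_v}` with `γ^N ∈ ker κ · g|_{K̄}`:

* `exists_zpExtension_kerSubgroup_eq_localSubgroup_of_norm_le` — for a `ℤ_p`-extension `κ` of a field `K`, a field `E/K` and
  `g ∈ Γ_E` with `κ(g|_{K̄}) ≠ 0` of MAXIMAL norm among the `κ(σ|_{K̄})`: a `ℤ_p`-extension `κ_E` of `E` with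
  `ker κ_E = Gal(K̄_E/(K_∞)_w)` (`localSubgroup`) and topological generator `g` — the tree's
  `ZpExtension.exists_local_kerSubgroup_eq_localSubgroup` (which CHOOSES `g` of maximal norm) with `g` prescribed; same proof
  (rescale the coordinate by its value at `g`; the image is closed and contains `ℤ`);
* `twistExponent_eq_mod_of_apply_eq` — `κ σ = N ⇒ twistExponent κ J σ = N mod p^J` (so `σ` acts on `M(χ_u)` through `u^N`);
* `apply_eq_ofAdd_of_pow_eq_mul` — `γ^N = h · σ`, `h ∈ ker κ`, `κ γ = 1` ⇒ `κ σ = N` (the door's admissibility clause).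

HONEST FRAMING: closes nothing; 23110 is NOT proved; BSD is not proved by any of this.
References: [Washington1997] §13.1–§13.2; [GreenbergLNM1716] §4 p. 105, proof of Lemma 4.7 (p. 108).
-/

set_option autoImplicit false
-- the Theorems namespace of this sub repeats the summit name by design (D-0017 nested layout)
set_option linter.dupNamespace false

noncomputable section

open scoped Classical NNReal

open NumberField IsDedekindDomain Field CategoryTheory

universe u

namespace Summit.BirchSwinnertonDyer.BirchSwinnertonDyer.Theorems.SignedEC.TwistedLocalDescent

open Literature.NumberTheory.EllipticCurves Literature.NumberTheory.GaloisRepresentations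
  Literature.NumberTheory.EllipticCurves.ZpExtension WeierstrassCurve

/-! ## §1 The local `ℤ_p`-extension with a PRESCRIBED topological generator -/

/-- **The local `ℤ_p`-extension cut out by `κ` at a completion, with a prescribed generator.** Let `κ` be a `ℤ_p`-extension of a
field `K`, `E` a field over `K` (a completion), and `g ∈ Γ_E` an element whose coordinate `κ(g|_{K̄})` is non-trivial and of MAXIMAL
norm among the `κ(σ|_{K̄})`, `σ ∈ Γ_E` (i.e. `g` topologically generates the image of `Γ_E` in `Gal(K_∞/K) ≅ ℤ_p`). Then there is a
`ℤ_p`-extension `κ_E` of `E` with `ker κ_E = Γ_E ∩ (·|_{K̄})⁻¹(ker κ) = Gal(K̄_E/(K_∞)_w)` and topological generator `g` (rescale the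
coordinate by its value at `g`). The tree's `ZpExtension.exists_local_kerSubgroup_eq_localSubgroup` is the same construction with `g`
CHOSEN of maximal norm; here `g` is given. [cite: Washington1997, §13.1–§13.2] [cite: GreenbergLNM1716, §4 p. 108] -/
theorem exists_zpExtension_kerSubgroup_eq_localSubgroup_of_norm_le {K : Type u} [Field K] {p : ℕ} [Fact p.Prime]
    (κ : ZpExtension K p) (E : Type u) [Field E] [Algebra K E] {g : absoluteGaloisGroup E}
    (hg0 : resGal (K := K) E g ∉ κ.kerSubgroup)
    (hmax : ∀ σ : absoluteGaloisGroup E, ‖(κ (resGal (K := K) E σ)).toAdd‖ ≤ ‖(κ (resGal (K := K) E g)).toAdd‖) :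
    ∃ κE : ZpExtension E p, κE.kerSubgroup = localSubgroup κ.kerSubgroup E ∧ κE.IsTopGenerator g := by
  -- adapted from Literature/…/Greenberg1999/LocalTowerKummerVanishingProofs.lean (`exists_local_kerSubgroup_eq_localSubgroup`)
  haveI : CompactSpace (absoluteGaloisGroup E) := absoluteGaloisGroup_compactSpace E
  -- the additive coordinate `a σ = κ(res σ) ∈ ℤ_p`
  let a : absoluteGaloisGroup E → ℤ_[p] := fun σ ↦ (κ (resGal (K := K) E σ)).toAdd
  have ha_cont : Continuous a :=
    continuous_toAdd.comp ((map_continuous κ).comp (map_continuous (resGal (K := K) E)))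
  have ha_mul : ∀ σ τ, a (σ * τ) = a σ + a τ := fun σ τ ↦ by
    simp only [a, map_mul, toAdd_mul]
  set x₀ : ℤ_[p] := a g with hx₀def
  have hx₀ : x₀ ≠ 0 := fun h0 ↦ hg0 (by
    rw [ZpExtension.mem_kerSubgroup]
    exact Multiplicative.toAdd.injective (by rw [toAdd_one]; exact h0))
  have hx₀' : (x₀ : ℚ_[p]) ≠ 0 := PadicInt.coe_ne_zero.mpr hx₀
  -- the rescaled coordinate `y σ = a σ / x₀ ∈ ℤ_p`
  have hnorm : ∀ σ, ‖(a σ : ℚ_[p]) / (x₀ : ℚ_[p])‖ ≤ 1 := fun σ ↦ by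
    rw [norm_div, PadicInt.padic_norm_e_of_padicInt, PadicInt.padic_norm_e_of_padicInt]
    exact div_le_one_of_le₀ (hmax σ) (norm_nonneg _)
  let y : absoluteGaloisGroup E → ℤ_[p] := fun σ ↦ ⟨(a σ : ℚ_[p]) / (x₀ : ℚ_[p]), hnorm σ⟩
  have hy_mul : ∀ σ τ, y (σ * τ) = y σ + y τ := fun σ τ ↦ by
    apply Subtype.ext
    change (a (σ * τ) : ℚ_[p]) / (x₀ : ℚ_[p]) = (a σ : ℚ_[p]) / x₀ + (a τ : ℚ_[p]) / x₀
    rw [ha_mul, PadicInt.coe_add, add_div]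
  have hy_one : y 1 = 0 := by
    have h := hy_mul 1 1
    rw [mul_one] at h
    linear_combination -h
  have hy_g : y g = 1 := by
    apply Subtype.ext
    change (a g : ℚ_[p]) / (x₀ : ℚ_[p]) = 1
    rw [← hx₀def, div_self hx₀']
  have hy_cont : Continuous y :=
    ((continuous_subtype_val.comp ha_cont).div_const _).subtype_mk _
  have hy_x₀ : ∀ σ, a σ = y σ * x₀ := fun σ ↦ by
    apply Subtype.ext
    rw [PadicInt.coe_mul]
    change (a σ : ℚ_[p]) = (a σ : ℚ_[p]) / x₀ * x₀
    rw [div_mul_cancel₀ _ hx₀']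
  -- the rescaled continuous homomorphism `Γ_E →ₜ* ℤ_p`
  let φ : absoluteGaloisGroup E →ₜ* Multiplicative ℤ_[p] :=
    { toFun := fun σ ↦ Multiplicative.ofAdd (y σ)
      map_one' := by rw [hy_one, ofAdd_zero]
      map_mul' := fun σ τ ↦ by rw [hy_mul, ofAdd_add]
      continuous_toFun := continuous_ofAdd.comp hy_cont }
  have hφ : ∀ σ, φ σ = Multiplicative.ofAdd (y σ) := fun _ ↦ rfl
  have hφg : φ g = Multiplicative.ofAdd 1 := by rw [hφ, hy_g]
  -- surjectivity: the image is a closed subgroup of `ℤ_p` containing `ℤ`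
  have hsurj : Function.Surjective φ := by
    have hclosed : IsClosed (Set.range φ) := (isCompact_range φ.continuous_toFun).isClosed
    have hsub : Set.range (fun n : ℤ ↦ Multiplicative.ofAdd ((n : ℤ) : ℤ_[p])) ⊆ Set.range φ := by
      rintro _ ⟨n, rfl⟩
      refine ⟨g ^ n, ?_⟩
      rw [map_zpow, hφg, ← ofAdd_zsmul, zsmul_eq_mul, mul_one]
    have hdense : DenseRange (fun n : ℤ ↦ Multiplicative.ofAdd ((n : ℤ) : ℤ_[p])) :=
      (Multiplicative.ofAdd.surjective.denseRange).comp PadicInt.denseRange_intCast continuous_ofAdd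
    have huniv : Set.range φ = Set.univ := by
      have hd : Dense (Set.range φ) := hdense.mono hsub
      rw [← hclosed.closure_eq, hd.closure_eq]
    intro x
    have hx : x ∈ Set.range φ := by rw [huniv]; exact Set.mem_univ x
    exact hx
  refine ⟨⟨φ, hsurj⟩, ?_, hφg⟩
  -- the kernel is `res⁻¹(ker κ)`
  ext σ
  rw [ZpExtension.mem_kerSubgroup, mem_localSubgroup_iff, ZpExtension.mem_kerSubgroup]
  change φ σ = 1 ↔ _
  rw [hφ]
  constructor
  · intro h
    have hy0 : y σ = 0 := Multiplicative.ofAdd.injective (by rw [h, ofAdd_zero])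
    have ha0 : a σ = 0 := by rw [hy_x₀ σ, hy0, zero_mul]
    exact Multiplicative.toAdd.injective (by rw [toAdd_one]; exact ha0)
  · intro h
    have ha0 : a σ = 0 := by
      change (κ (resGal (K := K) E σ)).toAdd = 0
      rw [h, toAdd_one]
    have hy0 : y σ = 0 := by
      apply Subtype.ext
      change (a σ : ℚ_[p]) / (x₀ : ℚ_[p]) = 0
      rw [ha0, PadicInt.coe_zero, zero_div]
    rw [hy0, ofAdd_zero]

/-! ## §2 The twist exponent of an admissible element -/

/-- **`κ σ = N ⇒ twistExponent κ J σ = N mod p^J`**: an element whose coordinate is the natural number `N` (e.g. `σ = g_v|_{K̄}` with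
`γ^N ∈ ker κ · g_v|_{K̄}`, `κ γ = 1`) acts on every `p^J`-torsion twist `M(χ_u)` through `u^{N mod p^J} = u^N`.
[cite: Washington1997, §13.1–§13.2] [cite: GreenbergLNM1716, §4 p. 105] -/
theorem twistExponent_eq_mod_of_apply_eq {K : Type u} [Field K] {p : ℕ} [Fact p.Prime] (κ : ZpExtension K p) (J : ℕ)
    {σ : absoluteGaloisGroup K} {N : ℕ} (hσ : κ σ = Multiplicative.ofAdd (N : ℤ_[p])) :
    κ.twistExponent J σ = N % p ^ J := by
  rw [ZpExtension.twistExponent, hσ, toAdd_ofAdd, map_natCast, ZMod.val_natCast]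

/-- **`γ^N = h · σ` with `h ∈ ker κ` and `κ γ = 1` gives `κ σ = N`.** [cite: Washington1997, §13.1–§13.2] -/
theorem apply_eq_ofAdd_of_pow_eq_mul {K : Type u} [Field K] {p : ℕ} [Fact p.Prime] (κ : ZpExtension K p)
    {γ : absoluteGaloisGroup K} (hγ : κ.IsTopGenerator γ) {N : ℕ} {σ h : absoluteGaloisGroup K} (hh : h ∈ κ.kerSubgroup)
    (hN : γ ^ N = h * σ) : κ σ = Multiplicative.ofAdd (N : ℤ_[p]) := by
  have h1 : κ (γ ^ N) = κ h * κ σ := by rw [hN, map_mul]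
  rw [ZpExtension.mem_kerSubgroup] at hh
  rw [hh, one_mul, map_pow, show κ γ = Multiplicative.ofAdd 1 from hγ, ← ofAdd_nsmul, nsmul_eq_mul, mul_one] at h1
  exact h1.symm

end Summit.BirchSwinnertonDyer.BirchSwinnertonDyer.Theorems.SignedEC.TwistedLocalDescent

end
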